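import Summits.QuantumFields.YangMills.Theorems.BalabanUVNodesN07FrakGOfRecordGaugeCovariance
import Literature.MathematicalPhysics.QuantumFieldTheory.Balaban1983to89.Node00.BgCurrentOfRecord
import Literature.MathematicalPhysics.QuantumFieldTheory.Balaban1983to89.B9Eq3117Current
import HarnessLib

/-!
# NODE N07 — [B9] (3.28)∕(3.11) GAUGE COVARIANCE OF def-Y's CURRENT OF RECORD `J(U₀)` (`Node00.JOfRecordAtBg`, M2 file 3d′), THE GAUGE INVARIANCE OF
# ITS `|·|₍₋₃₎`-NORM AND OF THE (14)-CURRENT CLAUSE `InU2cur`, THE LETTERS ON THE FLAT ORBIT, AND `tr J(b) = 0` AT `N = 2`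

Cell `pub-ymgap`, width seat `pub-ymgap-dag-n07-w3` (g25), INTENT-1 ∕ CLAIM-1.  `--kind proof --supports stmt-QuantumFields-27238 --as helper`; count-neutral.
[B9] = [Balaban1985BackgroundPropagators]; [15] = [Balaban1985Variational].

WHY.  def-Y's ✓`Node00/BgCurrentOfRecord.lean` pins the `J`-slot of the record instance of [15] Prop. 6 as lit's `B11Eq98CurrentSlot.Jcur` at
`unitsOfRecord F N U₀`, with (28) `‖J(U₀)‖₍₋₃₎ ≤ C₁B₃ε₁` under the DISPLAYED hypothesis `B11Prop6Concrete.InU2cur … (unitsOfRecord F N U₀)` (the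
current clause of (2)∕(14) read bondwise).  [B9] p. 398: *«All these inequalities are invariant with respect to gauge transformations of U»* — for the
current this is (3.28) read through (3.11): `U^u(∂p) = u(x)U(∂p)u(x)⁻¹`, `Im` and `D*_{U}` are conjugated, so `J(U^u)(b) = u(b₋)J(U)(b)u(b₋)⁻¹`, the
size `|·|₍₋₃₎` is unchanged (unitary conjugation is an isometry of `M_N(ℂ)`), and the hypothesis `InU2cur` is a property of the GAUGE ORBIT.  Lit HAS the
generic covariance of r08's letters (✓`B9Eq3117Current`: `gaugeTr`, `plaqU_gaugeTr`, `covDstar_gaugeTr`, `divP_gaugeTr`, `imC_conj`, ★`J_gaugeTr` — CITED, not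
restated); this file adds the two generic rows it lacks (the (14)-current `D^{η*}_U ∂U` under `gaugeTr`, traces through `D*`) and reads everything AT THE RECORD
(§2–§3: def-Y's `unitsOfRecord (u • U₀)` IS lit's `gaugeTr` of `unitsOfRecord U₀`), so that the (τ)-row tokens T-J ∕ (28) and their E1∕E2 inhabitation examples
transport along orbits by name, exactly as this seat's g24 files did for `𝔊` (✓`…N07FrakGOfRecordGaugeCovariance`) and `H₁` (✓`…N07H1OfRecordGaugeCovariance`).

WHAT IS PROVED (sorry-free; no definition; axioms standard).
* §1 (generic r08 letters, any ring `𝔸` over `ℂ`, shifts `T`, background `U`, gauge function `g`, lit's `gaugeTr T g U`): `plaqField_gaugeTr`,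
  ★ `divPη_plaqField_gaugeTr` (the (14)-current `D^{η*}_U∂U` is conjugated: `(D^{η*}_{U^g}∂U^g)(b) = R(g(b₋))(D^{η*}_U∂U)(b)`); `trace_covDstar`, `trace_divP_eq_zero`
  (traces of `D*`-images of tracefree plaquette functions vanish).
* §2 (the record): `ucur_unitsOfRecord_gaugeAct` (dictionary: `Ucur (unitsOfRecord (u • U₀)) = gaugeTr Tsh g (Ucur (unitsOfRecord U₀))` with
  `g = suToUnits ∘ u ∘ siteToLit⁻¹`, by this seat's ✓`unitsOfRecord_gaugeAct`), ★★ `JOfRecordAtBg_gaugeAct` (`J(u • U₀)(b) = Ad_{u(b₋)} J(U₀)(b)`, lit ✓`J_gaugeTr` at the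
  record), ★★ `norm_JOfRecordAtBg_gaugeAct` (`‖J(u • U₀)‖₍₋₃₎ = ‖J(U₀)‖₍₋₃₎`), `JOfRecordAtBg_pureGauge` (`J(u • 1) = 0`: E1 on the whole flat orbit).
* §3 ★★ `inU2cur_unitsOfRecord_gaugeAct_iff` (def-Y's displayed hypothesis of (28) is gauge invariant), `inU2cur_unitsOfRecord_one` (E2: inhabited at the unit
  background for every radius `a ≥ 0`), `inU2cur_unitsOfRecord_pureGauge` (and on the flat orbit), `norm_JOfRecordAtBg_gaugeAct_le` ((28) at `u • U₀` from the
  clause at `U₀`).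
* §4 `plaqU_unitsOfRecord_eq_suToUnits` (the record's plaquette variables are `SU(N)`-valued), `trace_suToUnits_inv_two` (`tr s⁻¹ = tr s` in `SU(2)`),
  `trace_imC_suToUnits_two`, ★ `trace_JOfRecordAtBg_apply_two` — **`tr J(U₀)(b) = 0` at the record `N = 2`** (def-Y's owed fibre item (v2-c): real traces in
  `SU(2)`; for `N ≥ 3` print's `π` is needed and nothing is claimed).

HONEST SCOPE.  Covariance ∕ fibre bookkeeping only: no estimate of the series is proved or used; the T-J glue «(14)-of-record ⇒ `InU2cur`» is NOT here
(located: `Node00.bgReg` types the PLAQUETTE clause of [I] (1.2) only — divergence D-defB-1 of `Node00/BackgroundActionOfRecord` — and the current clause is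
separate information, not derivable from it uniformly in `k`); `hpos` for the `QprimeOfRecord` pin and at small field OPEN; P0 ⟨26900⟩ OPEN; K0ᴬ∕K1ᴬ∕K3ᴬ OPEN;
N07 NOT discharged; COUNT 8∕28 · K 1∕4 UNMOVED; finite `𝕋⁴` at fixed `ε` — R4 closes only the conditional finite-𝕋⁴ rung `BalabanLadder.UV`, never the summit;
nothing continuum ∕ ℝ⁴ ∕ OS; the Yang–Mills mass gap (Clay) is NOT proved by any of this.  No `sorry`, no `def`, no `instance`, no `notation`.

References: [B9] (3.1)–(3.11) pp. 390–392, (3.28)–(3.30) p. 395, p. 398; [15] (2) p. 278, (14) p. 280, (27)–(28) p. 282.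
-/

set_option autoImplicit false

noncomputable section

open scoped Matrix.Norms.L2Operator InnerProductSpace ComplexConjugate Matrix

namespace Summit.QuantumFields.YangMills.Theorems.N07JOfRecordGaugeCovariance

open Literature.MathematicalPhysics.QuantumFieldTheory.Balaban1983to89
open Literature.MathematicalPhysics.QuantumFieldTheory.Balaban1983to89.T4Continuum (T4Family)
open T4Continuum
open B4Sect5Torus (TSite)
open B9SectCLatticeCarrier (Bond bpos btgt)
open B9Eq39Adjoint (R R_def R_sub R_smul R_zero R_inv_R covDstar plaqU divP divPη J)
open B9Eq3117Current (gaugeTr plaqU_gaugeTr divP_gaugeTr J_gaugeTr)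
open B9Eq37Insertion (imC)
open B11Eq27Current (plaqField)
open B11Eq90V0primeCurrent (Tsh Ucur)
open B11Eq115Space (NegSup levWeight levWeight_pos)
open B11Prop6Concrete (InU2cur)
open B9Eq328GaugeAction (gaugeU gaugeU_apply AdA AdA_apply)
open B9Eq34CovCurlVector (shift_comm)
open Node00
open Summit.QuantumFields.YangMills.Theorems.N07LaplaceAOfRecordGaugeOrbitPos (unitsOfRecord_gaugeAct suToUnits_mul suToUnits_inv)
open Summit.QuantumFields.YangMills.Theorems.N07FrakGOfRecordGaugeCovariance (norm_AdA_suToUnits norm_negSizeLit_AdA)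
open GaugeField (gaugeAct)

/-! ## §1  Generic: the (14)-current `D^{η*}_U ∂U` under lit's `gaugeTr`, and traces through `D*` -/

section Generic

variable {𝔸 : Type*} [Ring 𝔸] [Algebra ℂ 𝔸] {S ι : Type*} (T : ι → Equiv.Perm S) (U : ι → S → 𝔸ˣ) (g : S → 𝔸ˣ)

omit [Algebra ℂ 𝔸] in
/-- The plaquette field `∂U` is conjugated: `∂(U^g)(p) = R(g(x)) ∂U(p)` (lit ✓`plaqU_gaugeTr` read on `B11Eq27Current.plaqField`).
[cite: Balaban1985Variational, (2) p.278; Balaban1985BackgroundPropagators, (3.29) p.395] -/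
theorem plaqField_gaugeTr (hT : ∀ (μ ν : ι) (x : S), T μ (T ν x) = T ν (T μ x)) :
    plaqField T (gaugeTr T g U) = fun κ ν y => R (g y) (plaqField T U κ ν y) := by
  funext κ ν y
  simp only [plaqField, plaqU_gaugeTr T U hT, R_def, Units.val_mul]

variable [Fintype ι] [LinearOrder ι]

/-- ★ **THE (14)-CURRENT `D^{η*}_U ∂U` IS CONJUGATED**: `(D^{η*}_{U^g} ∂U^g)(b) = R(g(b₋)) (D^{η*}_U ∂U)(b)` (lit ✓`divP_gaugeTr` + `plaqField_gaugeTr`).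
[cite: Balaban1985Variational, (2) p.278, (14) p.280; Balaban1985BackgroundPropagators, (3.28)–(3.30) p.395] -/
theorem divPη_plaqField_gaugeTr (hT : ∀ (μ ν : ι) (x : S), T μ (T ν x) = T ν (T μ x)) (η : ℝ) (μ : ι) (x : S) :
    divPη T (gaugeTr T g U) η (plaqField T (gaugeTr T g U)) μ x = R (g x) (divPη T U η (plaqField T U) μ x) := by
  simp only [divPη]
  rw [plaqField_gaugeTr T U g hT, divP_gaugeTr, R_smul]

omit [Algebra ℂ 𝔸] [Fintype ι] [LinearOrder ι] in
/-- Traces through `D*_μ`: `τ (D*_{U,μ}G)(x) = τ G(T_μ⁻¹x) − τ G(x)` for any trace-like additive `τ` (`τ(ab) = τ(ba)`, so `τ(R(V)X) = τ X`). [folklore]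
[cite: Balaban1985BackgroundPropagators, (3.8) p.392] -/
theorem trace_covDstar {Φ : Type*} [FunLike Φ 𝔸 ℂ] [AddMonoidHomClass Φ 𝔸 ℂ] (τ : Φ) (hτ : ∀ a b : 𝔸, τ (a * b) = τ (b * a))
    (μ : ι) (G : S → 𝔸) (x : S) : τ (covDstar T U μ G x) = τ (G ((T μ).symm x)) - τ (G x) := by
  simp only [covDstar, map_sub, B9Eq39Adjoint.trace_R τ hτ]

omit [Algebra ℂ 𝔸] in
/-- `D*` of a `τ`-TRACEFREE plaquette function is `τ`-tracefree ((3.9) is a signed sum of `D*_ν`'s). [folklore] [cite: Balaban1985BackgroundPropagators, (3.9) p.392] -/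
theorem trace_divP_eq_zero {Φ : Type*} [FunLike Φ 𝔸 ℂ] [AddMonoidHomClass Φ 𝔸 ℂ] (τ : Φ) (hτ : ∀ a b : 𝔸, τ (a * b) = τ (b * a))
    (F : ι → ι → S → 𝔸) (hF : ∀ κ ν y, τ (F κ ν y) = 0) (μ : ι) (x : S) : τ (divP T U F μ x) = 0 := by
  have hc : ∀ ν (G : S → 𝔸), (∀ y, τ (G y) = 0) → τ (covDstar T U ν G x) = 0 := fun ν G hG => by
    rw [trace_covDstar T U τ hτ, hG, hG, sub_zero]
  have hite : ∀ (P : Prop) [Decidable P] (X : 𝔸), τ X = 0 → τ (if P then X else 0) = 0 := fun P _ X hX => by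
    split_ifs
    · exact hX
    · exact map_zero τ
  simp only [divP, map_sub, map_sum]
  rw [Finset.sum_eq_zero fun ν _ => hite _ _ (hc ν _ fun y => hF ν μ y), Finset.sum_eq_zero fun ν _ => hite _ _ (hc ν _ fun y => hF μ ν y),
    sub_zero]

end Generic

/-! ## §2  The record: `J(u • U₀) = Ad_u J(U₀)`, `‖J(u • U₀)‖ = ‖J(U₀)‖`, `J(u • 1) = 0` -/

section Record

variable (F : T4Family) (N : ℕ) [NeZero N] {K : ℕ} (k : ℕ) (Ω : ℕ → Set (Site (F.P K) 0))
variable (u : GaugeTransf (F.P K) 0 (SU N)) (U₀ : GaugeField (F.P K) 0 (SU N))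

/-- Lit's shifts commute on the periodic lattice (`shift_comm` in r08's letter `Tsh`). [cite: Balaban1985BackgroundPropagators, (3.1) p.390] -/
theorem tsh_comm (μ ν : Fin (F.P K).d) (x : TSite (F.P K).d (fun _ => (F.P K).sitesPerDir 0)) :
    (Tsh μ) ((Tsh ν) x) = (Tsh ν) ((Tsh μ) x) :=
  shift_comm μ ν x

/-- ★ **DICTIONARY**: in r08's curried letters the record's transporters at `u • U₀` ARE lit's `gaugeTr` of those at `U₀`, with gauge function
`g = suToUnits ∘ u ∘ siteToLit⁻¹` (this seat's ✓`unitsOfRecord_gaugeAct`, lit's `gaugeU` ∕ `gaugeTr`). [cite: Balaban1985BackgroundPropagators, (3.28) p.395] -/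
theorem ucur_unitsOfRecord_gaugeAct :
    Ucur (unitsOfRecord F N (gaugeAct u U₀)) =
      gaugeTr Tsh (fun y => suToUnits N (u ((siteToLit (F.P K) 0).symm y))) (Ucur (unitsOfRecord F N U₀)) := by
  rw [unitsOfRecord_gaugeAct]
  rfl

/-- ★★ **`J` OF RECORD IS GAUGE COVARIANT**: `J(u • U₀)(b) = Ad_{u(b₋)} J(U₀)(b)` bondwise ([B9] (3.30) «J^u = R(u)J», lit ✓`J_gaugeTr`, at def-Y's letter).
[cite: Balaban1985BackgroundPropagators, (3.28) p.395, p.398; Balaban1985Variational, (27)–(28) p.282] -/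
theorem JOfRecordAtBg_gaugeAct [Fact (0 < (F.L : ℝ))] [Fact (0 < (F.P K).eta k)] :
    NegSup.equiv (levWeight (F.L : ℝ) ((F.P K).eta k) (bondLevLit F Ω k) 3) (Matrix (Fin N) (Fin N) ℂ) (JOfRecordAtBg F N K k Ω (gaugeAct u U₀))
      = fun b => AdA (suToUnits N (u ((siteToLit (F.P K) 0).symm (bpos b))))
          (NegSup.equiv (levWeight (F.L : ℝ) ((F.P K).eta k) (bondLevLit F Ω k) 3) (Matrix (Fin N) (Fin N) ℂ) (JOfRecordAtBg F N K k Ω U₀) b) := by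
  funext b
  rw [JOfRecordAtBg_apply, JOfRecordAtBg_apply, ucur_unitsOfRecord_gaugeAct, J_gaugeTr _ _ (tsh_comm F), AdA_apply, R_def]

/-- ★★ **THE `|·|₍₋₃₎`-NORM OF `J` IS GAUGE INVARIANT**: `‖J(u • U₀)‖ = ‖J(U₀)‖` (unitary conjugation is an isometry of `M_N(ℂ)`; [B9] p. 398).
[cite: Balaban1985BackgroundPropagators, p.398; Balaban1985Variational, (28) p.282, p.286] -/
theorem norm_JOfRecordAtBg_gaugeAct [Fact (0 < (F.L : ℝ))] [Fact (0 < (F.P K).eta k)] :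
    ‖JOfRecordAtBg F N K k Ω (gaugeAct u U₀)‖ = ‖JOfRecordAtBg F N K k Ω U₀‖ :=
  norm_negSizeLit_AdA F N k Ω (fun b => u ((siteToLit (F.P K) 0).symm (bpos b))) _ _ (JOfRecordAtBg_gaugeAct F N k Ω u U₀)

/-- **E1 ON THE WHOLE FLAT ORBIT: `J(u • 1) = 0`** (def-Y's `JOfRecordAtBg_one` transported by covariance). [cite: Balaban1985Variational, (27)–(28) p.282] -/
theorem JOfRecordAtBg_pureGauge [Fact (0 < (F.L : ℝ))] [Fact (0 < (F.P K).eta k)] :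
    JOfRecordAtBg F N K k Ω (gaugeAct u (1 : GaugeField (F.P K) 0 (SU N))) = 0 := by
  apply (NegSup.equiv (levWeight (F.L : ℝ) ((F.P K).eta k) (bondLevLit F Ω k) 3) (Matrix (Fin N) (Fin N) ℂ)).injective
  rw [JOfRecordAtBg_gaugeAct, JOfRecordAtBg_one, B11Eq115Space.NegSup.equiv_zero]
  funext b
  exact map_zero _

end Record

/-! ## §3  The (14)-current clause `InU2cur` at the record is gauge invariant; E2 at the unit background and on the flat orbit -/

section Clause

variable (F : T4Family) (N : ℕ) [NeZero N] {K : ℕ} (k : ℕ) (Ω : ℕ → Set (Site (F.P K) 0))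
variable (u : GaugeTransf (F.P K) 0 (SU N)) (U₀ : GaugeField (F.P K) 0 (SU N))

/-- The (14)-current `(D^{η*}_{U₀}∂U₀)(b)` of the record at `u • U₀` is `Ad_{u(b₋)}` of the one at `U₀`.
[cite: Balaban1985Variational, (2) p.278, (14) p.280; Balaban1985BackgroundPropagators, (3.28) p.395] -/
theorem divPη_plaqField_unitsOfRecord_gaugeAct (η : ℝ) (b : Bond (F.P K).d (fun _ => (F.P K).sitesPerDir 0)) :
    divPη Tsh (Ucur (unitsOfRecord F N (gaugeAct u U₀))) η (plaqField Tsh (Ucur (unitsOfRecord F N (gaugeAct u U₀)))) b.2 b.1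
      = AdA (suToUnits N (u ((siteToLit (F.P K) 0).symm (bpos b))))
          (divPη Tsh (Ucur (unitsOfRecord F N U₀)) η (plaqField Tsh (Ucur (unitsOfRecord F N U₀))) b.2 b.1) := by
  rw [ucur_unitsOfRecord_gaugeAct, divPη_plaqField_gaugeTr _ _ _ (tsh_comm F), AdA_apply, R_def]

/-- ★★ **def-Y's DISPLAYED HYPOTHESIS OF (28) IS GAUGE INVARIANT**: `InU2cur L η lev a (unitsOfRecord (u • U₀)) ↔ InU2cur L η lev a (unitsOfRecord U₀)` for every
radius `a`, spacing `η` and level map — the current clause of (2)∕(14) is a property of the gauge orbit. [cite: Balaban1985Variational, (2) p.278, (14) p.280; Balaban1985BackgroundPropagators, p.398] -/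
theorem inU2cur_unitsOfRecord_gaugeAct_iff (L η a : ℝ) (lev : Bond (F.P K).d (fun _ => (F.P K).sitesPerDir 0) → ℕ) :
    InU2cur L η lev a (unitsOfRecord F N (gaugeAct u U₀)) ↔ InU2cur L η lev a (unitsOfRecord F N U₀) := by
  refine forall_congr' fun b => ?_
  rw [divPη_plaqField_unitsOfRecord_gaugeAct, norm_AdA_suToUnits]

omit [NeZero N] in
/-- At the unit transporters every plaquette variable is `1` and every `D*`-image of the (constant) plaquette field vanishes. [cite: Balaban1985Variational, (2) p.278] -/
theorem divPη_plaqField_one (η : ℝ) (μ : Fin (F.P K).d) (x : TSite (F.P K).d (fun _ => (F.P K).sitesPerDir 0)) :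
    divPη Tsh (Ucur (1 : Bond (F.P K).d (fun _ => (F.P K).sitesPerDir 0) → (Matrix (Fin N) (Fin N) ℂ)ˣ)) η
        (plaqField Tsh (Ucur (1 : Bond (F.P K).d (fun _ => (F.P K).sitesPerDir 0) → (Matrix (Fin N) (Fin N) ℂ)ˣ))) μ x = 0 := by
  simp [divPη, divP, covDstar, plaqField, plaqU, Ucur, R_def]

/-- **E2 AT THE UNIT BACKGROUND**: `InU2cur L η_k lev a (unitsOfRecord 1)` for EVERY `a ≥ 0` (the current of the unit configuration is `0`) — def-Y's displayed
hypothesis of (28) is inhabited at `U₀ = 1` (RR-2's E-guard receipt, now tree content). [cite: Balaban1985Variational, (2) p.278, (14) p.280] -/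
theorem inU2cur_unitsOfRecord_one [Fact (0 < (F.L : ℝ))] [Fact (0 < (F.P K).eta k)] {a : ℝ} (ha : 0 ≤ a)
    (lev : Bond (F.P K).d (fun _ => (F.P K).sitesPerDir 0) → ℕ) :
    InU2cur (F.L : ℝ) ((F.P K).eta k) lev a (unitsOfRecord F N (1 : GaugeField (F.P K) 0 (SU N))) := by
  intro b
  rw [unitsOfRecord_one, divPη_plaqField_one, norm_zero]
  have hw : 0 < levWeight (F.L : ℝ) ((F.P K).eta k) lev 1 b := levWeight_pos Fact.out Fact.out lev 1 b
  positivity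

/-- **E2 ON THE FLAT ORBIT**: `InU2cur L η_k lev a (unitsOfRecord (u • 1))` for every `a ≥ 0`. [cite: Balaban1985Variational, (2) p.278, (14) p.280] -/
theorem inU2cur_unitsOfRecord_pureGauge [Fact (0 < (F.L : ℝ))] [Fact (0 < (F.P K).eta k)] {a : ℝ} (ha : 0 ≤ a)
    (lev : Bond (F.P K).d (fun _ => (F.P K).sitesPerDir 0) → ℕ) :
    InU2cur (F.L : ℝ) ((F.P K).eta k) lev a (unitsOfRecord F N (gaugeAct u (1 : GaugeField (F.P K) 0 (SU N)))) :=
  (inU2cur_unitsOfRecord_gaugeAct_iff F N u 1 _ _ a lev).2 (inU2cur_unitsOfRecord_one F N k ha lev)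

/-- **(28) ALONG THE ORBIT**: the clause at `U₀` gives `‖J(u • U₀)‖₍₋₃₎ ≤ C₁B₃ε₁` at every gauge transform (def-Y's `norm_JOfRecordAtBg_le` + §2∕§3).
[cite: Balaban1985Variational, (28) p.282, (14) p.280] -/
theorem norm_JOfRecordAtBg_gaugeAct_le [Fact (0 < (F.L : ℝ))] [Fact (0 < (F.P K).eta k)] {C₁ B₃ ε₁ : ℝ} (hK : 0 ≤ C₁ * B₃ * ε₁)
    (h14 : InU2cur (F.L : ℝ) ((F.P K).eta k) (bondLevLit F Ω k) (C₁ * B₃ * ε₁) (unitsOfRecord F N U₀)) :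
    ‖JOfRecordAtBg F N K k Ω (gaugeAct u U₀)‖ ≤ C₁ * B₃ * ε₁ := by
  rw [norm_JOfRecordAtBg_gaugeAct]
  exact norm_JOfRecordAtBg_le hK h14

end Clause

/-! ## §4  `tr J(U₀)(b) = 0` at the record `N = 2` (real traces in `SU(2)`) -/

section Trace

variable (F : T4Family) {K : ℕ} (k : ℕ) (Ω : ℕ → Set (Site (F.P K) 0))

/-- The record's plaquette variables are `SU(N)`-valued: `Ucur (unitsOfRecord U₀)(∂p) = suToUnits (…)` for an explicit `SU(N)` word.
[cite: Balaban1985BackgroundPropagators, (3.1) p.390] -/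
theorem plaqU_unitsOfRecord_eq_suToUnits (N : ℕ) (U₀ : GaugeField (F.P K) 0 (SU N)) (μ ν : Fin (F.P K).d)
    (x : TSite (F.P K).d (fun _ => (F.P K).sitesPerDir 0)) :
    plaqU Tsh (Ucur (unitsOfRecord F N U₀)) μ ν x = suToUnits N
      (U₀ ((bondToLit (F.P K) 0).symm (x, μ)) * U₀ ((bondToLit (F.P K) 0).symm ((Tsh μ) x, ν)) *
        (U₀ ((bondToLit (F.P K) 0).symm ((Tsh ν) x, μ)))⁻¹ * (U₀ ((bondToLit (F.P K) 0).symm (x, ν)))⁻¹) := by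
  simp only [plaqU, Ucur, unitsOfRecord, suToUnits_mul, suToUnits_inv]

/-- `tr s⁻¹ = tr s` for `s ∈ SU(2)` (the inverse is the adjugate, whose trace is the trace, for `2 × 2` matrices of determinant one). [folklore] -/
theorem trace_suToUnits_inv_two (s : SU 2) :
    Matrix.trace (((suToUnits 2 s)⁻¹ : (Matrix (Fin 2) (Fin 2) ℂ)ˣ) : Matrix (Fin 2) (Fin 2) ℂ) = Matrix.trace ((suToUnits 2 s : (Matrix (Fin 2) (Fin 2) ℂ)ˣ) : Matrix (Fin 2) (Fin 2) ℂ) := by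
  have hmem := Matrix.mem_specialUnitaryGroup_iff.mp s.2
  have hU : ((s : SU 2) : Matrix (Fin 2) (Fin 2) ℂ) * star ((s : SU 2) : Matrix (Fin 2) (Fin 2) ℂ) = 1 := Matrix.mem_unitaryGroup_iff.mp hmem.1
  have hdet : ((s : SU 2) : Matrix (Fin 2) (Fin 2) ℂ).det = 1 := hmem.2
  have hstar : star ((s : SU 2) : Matrix (Fin 2) (Fin 2) ℂ) = ((s : SU 2) : Matrix (Fin 2) (Fin 2) ℂ).adjugate := by
    rw [← Matrix.inv_eq_right_inv hU, Matrix.inv_def, hdet, Ring.inverse_one, one_smul]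
  rw [coe_suToUnits_inv, coe_inv_SU, coe_suToUnits, hstar, Matrix.adjugate_fin_two, Matrix.trace_fin_two, Matrix.trace_fin_two]
  simp only [Matrix.of_apply, Matrix.cons_val', Matrix.cons_val_zero, Matrix.cons_val_one, Matrix.empty_val', Matrix.cons_val_fin_one]
  ring

/-- `tr Im s = 0` for `s ∈ SU(2)` (`Im s = (2i)⁻¹(s − s⁻¹)` and `tr s⁻¹ = tr s`). [folklore] [cite: Balaban1985BackgroundPropagators, p.391] -/
theorem trace_imC_suToUnits_two (s : SU 2) : Matrix.trace (imC (suToUnits 2 s)) = 0 := by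
  rw [imC, Matrix.trace_smul, Matrix.trace_sub, trace_suToUnits_inv_two, sub_self, smul_zero]

/-- ★ **`tr J(U₀)(b) = 0` AT THE RECORD `N = 2`**: the current of record is tracefree bondwise for `SU(2)` (every plaquette variable has real trace, `R(·)` preserves
traces) — def-Y's owed fibre item (v2-c) for the `J`-slot; for `N ≥ 3` print's `𝔰𝔲`-projection `π` is needed and nothing is claimed.
[cite: Balaban1985Variational, (27)–(28) p.282; Balaban1985BackgroundPropagators, (3.11) p.392] -/
theorem trace_JOfRecordAtBg_apply_two [Fact (0 < (F.L : ℝ))] [Fact (0 < (F.P K).eta k)] (U₀ : GaugeField (F.P K) 0 (SU 2))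
    (b : Bond (F.P K).d (fun _ => (F.P K).sitesPerDir 0)) :
    Matrix.trace (NegSup.equiv (levWeight (F.L : ℝ) ((F.P K).eta k) (bondLevLit F Ω k) 3) (Matrix (Fin 2) (Fin 2) ℂ) (JOfRecordAtBg F 2 K k Ω U₀) b) = 0 := by
  rw [JOfRecordAtBg_apply]
  simp only [J, divPη, Matrix.trace_smul]
  have h := trace_divP_eq_zero Tsh (Ucur (unitsOfRecord F 2 U₀)) (Matrix.traceLinearMap (Fin 2) ℂ ℂ) (fun a b => Matrix.trace_mul_comm a b)
    (fun κ ν y => (((F.P K).eta k : ℂ)⁻¹ ^ 2) • imC (plaqU Tsh (Ucur (unitsOfRecord F 2 U₀)) κ ν y)) (fun κ ν y => by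
      rw [Matrix.traceLinearMap_apply, Matrix.trace_smul, plaqU_unitsOfRecord_eq_suToUnits, trace_imC_suToUnits_two, smul_zero]) b.2 b.1
  rw [Matrix.traceLinearMap_apply] at h
  rw [h, smul_zero]

end Trace

end Summit.QuantumFields.YangMills.Theorems.N07JOfRecordGaugeCovariance
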